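import Summits.AtomisticToContinuum.BoseEinsteinCondensation.Theses.BECCellInformation
import Summits.AtomisticToContinuum.BoseEinsteinCondensation.Theorems.BECCutLineWeakDisorderZeroModeOfLandscape

/-!
# Route `BECCellInformation` — support item `ZeroModeTransfer` (stmt-AtomisticToContinuum-13446)

Closes stmt-AtomisticToContinuum-13446 (exact signature of
`Summit.AtomisticToContinuum.BoseEinsteinCondensation.Theses.BECCellInformation.ZeroModeTransfer`):
the pure-bookkeeping glue

  `EnergyPerParticleBound → NonnegNearMinimiser → GroundStateRigidity → OccupationStability →
   (zero-mode bound for NON-NEGATIVE near-minimisers) → X_B1`,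

where X_B1 (zero-mode occupation `≥ c N` for EVERY `δ`-near-minimiser, all large `N`, every small
density) is verbatim the hypothesis of the proved frame theorem
`AtomisticToContinuum.BECInfraredBound.bec_of_zeroMode`.

Proof (as planned by the route; Lieb–Seiringer–Solovej–Yngvason 2005 §1.2 for the objects, the
argument is elementary): fix `v`; `ρ₀ := min` of the three thresholds; for `ρ < ρ₀` take `K` from the
energy bound and `c` from the zero-mode hypothesis, put `C := 1/c` and answer with the constant
`1/(4C) = c/4`. For large `N = n + 1`: `δ₁` from the zero-mode hypothesis, `δ₂` from rigidity at
`η := 1/(4C)`, `δ := min δ₁ δ₂`. Since `E₀ ≤ K N < ⊤`, `NonnegNearMinimiser` supplies a non-negative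
`δ`-near-minimiser `Ψ`, whose zero-mode occupation is `≥ c N`, i.e. `N ≤ occ(φ₀,Ψ)·C`. Any
`δ`-near-minimiser `Φ` is `√η`-close to `Ψ` up to a phase (rigidity), so `OccupationStability`
(with the measurable, normalised constant mode `φ₀ = L^{-3/2}·1_{Λ_L}`, `L > 0`) and the
`√`-bookkeeping lemma `zeroMode_sqrt_bookkeeping` of the sibling glue
`BECCutLineWeakDisorderZeroModeOfLandscape` give `occ(φ₀,Φ) ≥ N/(4C)`.
-/

noncomputable section

namespace Summit.AtomisticToContinuum.BoseEinsteinCondensation.Theorems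

open MeasureTheory ENNReal Filter Literature.MathematicalPhysics.QuantumManyBody.BoseGas

/-- Settles `stmt-AtomisticToContinuum-13446` (exact signature): the glue
`EnergyPerParticleBound → NonnegNearMinimiser → GroundStateRigidity → OccupationStability →
(zero-mode bound for non-negative near-minimisers) → X_B1` of route `BECCellInformation`, with
`ρ₀ = min`, `C = 1/c`, answer `1/(4C)`, `η = 1/(4C)`, `δ = min δ₁ δ₂`
(Lieb–Seiringer–Solovej–Yngvason 2005 §1.2 for the objects; elementary bookkeeping). [folklore] -/
theorem zeroModeTransfer_proof :
    Summit.AtomisticToContinuum.BoseEinsteinCondensation.Theses.BECCellInformation.ZeroModeTransfer := by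
  unfold Summit.AtomisticToContinuum.BoseEinsteinCondensation.Theses.BECCellInformation.ZeroModeTransfer
    Summit.AtomisticToContinuum.BoseEinsteinCondensation.Theses.BECCellInformation.GroundStateRigidity
  intro hEn hNN hRig hOcc hZero v hv
  obtain ⟨ρ₁, hρ₁, H₁⟩ := hEn v hv
  obtain ⟨ρ₂, hρ₂, H₂⟩ := hRig v hv
  obtain ⟨ρ₃, hρ₃, H₃⟩ := hZero v hv
  refine ⟨min ρ₁ (min ρ₂ ρ₃), lt_min hρ₁ (lt_min hρ₂ hρ₃), fun ρ hρ hρlt => ?_⟩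
  obtain ⟨K, hevE⟩ := H₁ ρ hρ (hρlt.trans_le (min_le_left _ _))
  have hevR := H₂ ρ hρ (hρlt.trans_le ((min_le_right _ _).trans (min_le_left _ _)))
  obtain ⟨c, hc, hevJ⟩ := H₃ ρ hρ (hρlt.trans_le ((min_le_right _ _).trans (min_le_right _ _)))
  obtain ⟨C, hC, hcC⟩ : ∃ C : ℝ, 0 < C ∧ c * C = 1 := ⟨c⁻¹, inv_pos.mpr hc, mul_inv_cancel₀ hc.ne'⟩
  refine ⟨1 / (4 * C), by positivity, ?_⟩
  filter_upwards [hevE, hevR, hevJ, Filter.eventually_gt_atTop 0] with N hEN hRN hJN hNpos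
  obtain ⟨n, rfl⟩ : ∃ n, N = n + 1 := ⟨N - 1, by omega⟩
  obtain ⟨δ₁, hδ₁, hzero⟩ := hJN
  obtain ⟨δ₂, hδ₂, hrig⟩ := hRN (1 / (4 * C)) (by positivity)
  refine ⟨min δ₁ δ₂, lt_min hδ₁ hδ₂, fun Φ hΦE => ?_⟩
  have hfin : groundStateEnergy v (n + 1) (sideLength ρ (n + 1)) ≠ ⊤ :=
    ne_top_of_le_ne_top ENNReal.ofReal_ne_top hEN
  obtain ⟨Ψ, hΨE, hΨnn⟩ := hNN v (n + 1) (sideLength ρ (n + 1)) hfin (min δ₁ δ₂) (lt_min hδ₁ hδ₂)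
  have hΨE₁ : energy v Ψ ≤ groundStateEnergy v (n + 1) (sideLength ρ (n + 1)) + δ₁ :=
    hΨE.trans (by gcongr; exact min_le_left _ _)
  have hΨE₂ : energy v Ψ ≤ groundStateEnergy v (n + 1) (sideLength ρ (n + 1)) + δ₂ :=
    hΨE.trans (by gcongr; exact min_le_right _ _)
  have hΦE₂ : energy v Φ ≤ groundStateEnergy v (n + 1) (sideLength ρ (n + 1)) + δ₂ :=
    hΦE.trans (by gcongr; exact min_le_right _ _)
  have hoccΨ := hzero Ψ hΨE₁ hΨnn
  obtain ⟨c₀, hc₀, hclose⟩ := hrig Ψ Φ hΨE₂ hΦE₂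
  have hLpos : 0 < sideLength ρ (n + 1) := by
    unfold sideLength
    exact Real.rpow_pos_of_pos (div_pos (Nat.cast_pos.mpr (Nat.succ_pos n)) hρ) _
  have hstab := hOcc n (sideLength ρ (n + 1)) _
    (_root_.AtomisticToContinuum.BECInfraredBound.aestronglyMeasurable_constMode _)
    (_root_.AtomisticToContinuum.BECInfraredBound.lintegral_constMode_sq hLpos) Ψ Φ c₀ hc₀
  have hK0 : ENNReal.ofReal C ≠ 0 := (ENNReal.ofReal_pos.mpr hC).ne'
  have hE : ∫⁻ X, (‖Ψ.ψ X - c₀ * Φ.ψ X‖₊ : ℝ≥0∞) ^ 2 ≤ (4 * ENNReal.ofReal C)⁻¹ := by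
    refine hclose.trans (le_of_eq ?_)
    rw [one_div, ENNReal.ofReal_inv_of_pos (by positivity), ENNReal.ofReal_mul (by norm_num),
      ENNReal.ofReal_ofNat]
  have h1 : ((n + 1 : ℕ) : ℝ≥0∞)
      ≤ occupation (n + 1) ((box (sideLength ρ (n + 1))).indicator
          fun _ => ((Real.sqrt (sideLength ρ (n + 1) ^ 3))⁻¹ : ℂ)) Ψ.ψ * ENNReal.ofReal C :=
    calc ((n + 1 : ℕ) : ℝ≥0∞) = ENNReal.ofReal (c * ((n + 1 : ℕ) : ℝ)) * ENNReal.ofReal C := by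
          rw [← ENNReal.ofReal_mul (by positivity), mul_right_comm, hcC, one_mul,
            ENNReal.ofReal_natCast]
      _ ≤ _ := by gcongr
  have key := zeroMode_sqrt_bookkeeping hK0 (ENNReal.natCast_ne_top (n + 1)) h1 hstab hE
  calc ENNReal.ofReal (1 / (4 * C) * ((n + 1 : ℕ) : ℝ))
      = ((n + 1 : ℕ) : ℝ≥0∞) / (4 * ENNReal.ofReal C) := by
        rw [ENNReal.ofReal_mul (by positivity), ENNReal.ofReal_natCast, one_div,
          ENNReal.ofReal_inv_of_pos (by positivity), ENNReal.ofReal_mul (by norm_num),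
          ENNReal.ofReal_ofNat, ENNReal.div_eq_inv_mul]
    _ ≤ _ := key

end Summit.AtomisticToContinuum.BoseEinsteinCondensation.Theorems

end
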